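import Summits.QuantumFields.BalabanUV.T4Continuum.Support.CTConjugationPieces

/-!
# T⁴ programme, SUBSTRATE (shared lattice-gauge analysis library) — WEIGHTED ENERGY ESTIMATES FOR A GRAM-PLUS-POSITIVE OPERATOR `A = XᴴX + Y`:
# the conjugated inverse `W A⁻¹ W⁻¹`, the conjugated `X A⁻¹`, and the DIVERGENCE-FORM solution `A⁻¹Xᴴ` with its gradient `X A⁻¹ Xᴴ`, all bounded
# in operator norm by the weighted coercivity, the conjugation defect of `A` and the conjugation error of `X` alone (programme VEC, file 3a)

Substrate cell `b2b-balaban-substrate-*`, seat p3.  VEC-1 (`CTWeightedCoercivity`) gives, for `A` with `WCoercive A κ ρ γw` and `ConjDefect A κ ρ J`,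
the weighted solution ∕ Gram bounds; VEC-2 (`CTConjugationPieces`, `CTConjugationTorus`) the algebra of `conjMat` and the conjugation errors of the
local pieces.  The projection term of Bałaban's propagators ([Balaban1984PropagatorsI] (1.70) `P = G′Q′*(Q′G′²Q′*)⁻¹Q′G′`,
[Balaban1985BackgroundPropagators] (3.25)) is sandwiched between a gradient and a divergence: `∂·P·∂ᴴ`.  Its conjugation smallness needs operator
bounds for the conjugates of `G′`, `∂G′`, `G′∂ᴴ` AND `∂G′∂ᴴ` — the last one is a DIVERGENCE-FORM estimate (source `∂ᴴu`, unbounded `∂ᴴ`), which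
this file proves from energy inequalities only:

 * §1 the real lemma **`energy_bound`**: `γ b² ≤ aF + c b F`, `a² ≤ aF + c b F + J b²` (`γ > 0`, all nonnegative) ⟹ `a ≤ K₁·F`, `b ≤ K₂·F` with
   **`K1 γ J c = √(2((1 + c²) + (1 + 2J)c²/γ² + 2(1 + 2J)²/γ²))`**, **`K2 γ J c = √(2K₁/γ + c²/γ²)`** (Young's inequality twice);
 * §2 for `A = XᴴX + Y`, `Y ⪰ 0`, `WCoercive A κ ρ γw` (`γw > 0`), `ConjDefect A κ ρ J`, a second weight `ρX` on the range of `X` with conjugation error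
   `‖conjMat κ ρX ρ X − X‖ ≤ c` and `‖conjMat κ ρ ρX Xᴴ − Xᴴ‖ ≤ c`:
   **`opNorm_conjMat_inv_le'`** `‖c(A⁻¹)‖ ≤ γw⁻¹`; **`opNorm_X_conjMat_inv_le`** `‖X·c(A⁻¹)‖ ≤ √(1/γw + J/γw²)`;
   **`opNorm_conjMat_X_inv_le`** `‖c(XA⁻¹)‖ ≤ √(1/γw + J/γw²) + c/γw`;
   the divergence form: **`divergence_energy`** (for `Ax = Xᴴu`: `‖X(e^{κρ}x)‖ ≤ K₁‖e^{κρX}u‖`, `‖e^{κρ}x‖ ≤ K₂‖e^{κρX}u‖`), hence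
   **`opNorm_conjMat_inv_XH_le`** `‖c(A⁻¹Xᴴ)‖ ≤ K₂`, **`opNorm_X_conjMat_inv_XH_le`** `‖X·c(A⁻¹Xᴴ)‖ ≤ K₁` and **`opNorm_conjMat_X_inv_XH_le`**
   `‖c(XA⁻¹Xᴴ)‖ ≤ K₁ + cK₂`.

HONEST FRAMING (T4-DAG p. 1).  Generic finite-dimensional linear algebra ([folklore]); no estimate of any NE row; nothing printed is a hypothesis or a
conclusion; no `def … : Prop` fact (two explicit constants are `def`s); spine 0/9 unchanged; NOT infinite volume ∕ mass gap ∕ Clay.  HONEST DEPENDENCY: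
continuum YM on T⁴ ⇐ BetaPertH ∧ nine spine estimates (0/9 proved); BetaPertH ⇐ (D1) ∧ (D4) ∧ CAP+tail; G-an2-4 gates asym, D1 and NE2/3/4.
ABSOLUTE RULE kept; no `sorry`.
-/

noncomputable section

open scoped BigOperators ComplexConjugate Matrix Matrix.Norms.L2Operator ComplexOrder

namespace Summit.QuantumFields.BalabanUV.T4Continuum.CTWeightedEnergy

open Literature.MathematicalPhysics.QuantumFieldTheory.Balaban1983to89.B5Prop11Lower (nsq nsq_nonneg norm_star_dotProduct_le nsq_mulVec_le
  norm_form_le)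
open Summit.QuantumFields.BalabanUV.T4Continuum
open Summit.QuantumFields.BalabanUV.T4Continuum.CoerciveInverseTower (Coercive)
open Summit.QuantumFields.BalabanUV.T4Continuum.GaugeTermResolventBounds (nsq_le_re_form)
open Summit.QuantumFields.BalabanUV.T4Continuum.GaugeTermCoercivity (nsq_mulVec_le_rect)
open Summit.QuantumFields.BalabanUV.T4Continuum.ScalarCovariantCTWeighted (wvec wvec_wvec_neg dotProduct_wvec)
open Summit.QuantumFields.BalabanUV.Beta.AccretiveCombesThomas (conjForm)
open Summit.QuantumFields.BalabanUV.T4Continuum.CTWeightedCoercivity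
open Summit.QuantumFields.BalabanUV.T4Continuum.CTConjugationPieces

/-! ## §1 The real energy lemma -/

/-- the gradient constant `K₁(γ, J, c) = √(2((1 + c²) + (1 + 2J)c²/γ² + 2(1 + 2J)²/γ²))`. [folklore] -/
def K1 (γ J c : ℝ) : ℝ := Real.sqrt (2 * ((1 + c ^ 2) + (1 + 2 * J) * c ^ 2 / γ ^ 2 + 2 * (1 + 2 * J) ^ 2 / γ ^ 2))

/-- the solution constant `K₂(γ, J, c) = √(2K₁/γ + c²/γ²)`. [folklore] -/
def K2 (γ J c : ℝ) : ℝ := Real.sqrt (2 * K1 γ J c / γ + c ^ 2 / γ ^ 2)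

/-- `0 ≤ K₁`. [folklore] -/
theorem K1_nonneg (γ J c : ℝ) : 0 ≤ K1 γ J c := Real.sqrt_nonneg _

/-- `0 ≤ K₂`. [folklore] -/
theorem K2_nonneg (γ J c : ℝ) : 0 ≤ K2 γ J c := Real.sqrt_nonneg _

/-- **THE ENERGY LEMMA**: from `γb² ≤ aF + cbF` and `a² ≤ aF + cbF + Jb²` (`γ > 0`; `a, b, F, c, J ≥ 0`) conclude `a ≤ K₁F` and `b ≤ K₂F`
(Young's inequality: `cbF ≤ (γ/2)b² + (c²/2γ)F²`, `aF ≤ a²/2 + F²/2`, `(1+2J)(2/γ)aF ≤ a²/2 + 2(1+2J)²F²/γ²`). [folklore] -/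
theorem energy_bound {γ J c a b F : ℝ} (hγ : 0 < γ) (hJ : 0 ≤ J) (ha : 0 ≤ a) (hb : 0 ≤ b) (hF : 0 ≤ F)
    (h1 : γ * b ^ 2 ≤ a * F + c * b * F) (h2 : a ^ 2 ≤ a * F + c * b * F + J * b ^ 2) :
    a ≤ K1 γ J c * F ∧ b ≤ K2 γ J c * F := by
  set m : ℝ := 1 + 2 * J with hm
  have hm0 : 0 ≤ m := by rw [hm]; linarith
  -- (i) `γ²b² ≤ 2γaF + c²F²` (Young on `cbF`)
  have h1γ : γ * (γ * b ^ 2) ≤ γ * (a * F + c * b * F) := mul_le_mul_of_nonneg_left h1 hγ.le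
  have hb2 : γ ^ 2 * b ^ 2 ≤ 2 * γ * (a * F) + c ^ 2 * F ^ 2 := by nlinarith [sq_nonneg (γ * b - c * F)]
  -- (ii) `a² ≤ (1 + c²)F² + m b²` (Young on `aF` and `cbF`)
  have ha2 : a ^ 2 ≤ (1 + c ^ 2) * F ^ 2 + m * b ^ 2 := by
    rw [hm]; nlinarith [sq_nonneg (a - F), sq_nonneg (c * F - b)]
  -- (iii) `γ²a² ≤ (2(1 + c²)γ² + 2mc² + 4m²)F²`
  have hA : γ ^ 2 * a ^ 2 ≤ γ ^ 2 * ((1 + c ^ 2) * F ^ 2 + m * b ^ 2) := mul_le_mul_of_nonneg_left ha2 (sq_nonneg γ)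
  have hB : m * (γ ^ 2 * b ^ 2) ≤ m * (2 * γ * (a * F) + c ^ 2 * F ^ 2) := mul_le_mul_of_nonneg_left hb2 hm0
  have hC := sq_nonneg (γ * a - 2 * m * F)
  have key : γ ^ 2 * a ^ 2 ≤ (2 * (1 + c ^ 2) * γ ^ 2 + 2 * m * c ^ 2 + 4 * m ^ 2) * F ^ 2 := by nlinarith
  have hK1sq : K1 γ J c ^ 2 * γ ^ 2 = 2 * (1 + c ^ 2) * γ ^ 2 + 2 * m * c ^ 2 + 4 * m ^ 2 := by
    rw [K1, Real.sq_sqrt (by positivity), ← hm]; field_simp; ring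
  have haK : a ≤ K1 γ J c * F := by
    have h0 : 0 ≤ K1 γ J c * F := mul_nonneg (K1_nonneg _ _ _) hF
    have hsq : a ^ 2 * γ ^ 2 ≤ (K1 γ J c * F) ^ 2 * γ ^ 2 := by
      rw [mul_pow, mul_assoc, mul_comm (F ^ 2), ← mul_assoc, hK1sq]; linarith
    exact (pow_le_pow_iff_left₀ ha h0 two_ne_zero).mp (le_of_mul_le_mul_right hsq (by positivity))
  refine ⟨haK, ?_⟩
  -- (iv) `γ²b² ≤ (2γK₁ + c²)F²`
  have hb3 : γ ^ 2 * b ^ 2 ≤ (2 * γ * K1 γ J c + c ^ 2) * F ^ 2 := by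
    have : 2 * γ * (a * F) ≤ 2 * γ * (K1 γ J c * F * F) :=
      mul_le_mul_of_nonneg_left (mul_le_mul_of_nonneg_right haK hF) (by positivity)
    nlinarith
  have hK2sq : K2 γ J c ^ 2 * γ ^ 2 = 2 * γ * K1 γ J c + c ^ 2 := by
    rw [K2, Real.sq_sqrt (by have := K1_nonneg γ J c; positivity)]; field_simp
  have h0 : 0 ≤ K2 γ J c * F := mul_nonneg (K2_nonneg _ _ _) hF
  have hsq : b ^ 2 * γ ^ 2 ≤ (K2 γ J c * F) ^ 2 * γ ^ 2 := by
    rw [mul_pow, mul_assoc, mul_comm (F ^ 2), ← mul_assoc, hK2sq]; linarith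
  exact (pow_le_pow_iff_left₀ hb h0 two_ne_zero).mp (le_of_mul_le_mul_right hsq (by positivity))

/-! ## §2 The operator statements -/

section Operator

variable {ι υ : Type*} [Fintype ι] [DecidableEq ι] [Fintype υ] [DecidableEq υ]
variable {A Y : Matrix ι ι ℂ} {X : Matrix υ ι ℂ} {κ : ℝ} {ρ : ι → ℝ} {ρX : υ → ℝ} {γw J c : ℝ}

/-- `√nsq (M v) ≤ ‖M‖·√nsq v` (rectangular). [folklore] -/
theorem sqrt_nsq_mulVec_le {m k : Type*} [Fintype m] [Fintype k] [DecidableEq m] [DecidableEq k] (Mx : Matrix m k ℂ) (v : k → ℂ) :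
    Real.sqrt (nsq (Mx *ᵥ v)) ≤ ‖Mx‖ * Real.sqrt (nsq v) := by
  calc Real.sqrt (nsq (Mx *ᵥ v)) ≤ Real.sqrt (‖Mx‖ ^ 2 * nsq v) := Real.sqrt_le_sqrt (nsq_mulVec_le_rect Mx v)
    _ = ‖Mx‖ * Real.sqrt (nsq v) := by rw [Real.sqrt_mul (sq_nonneg _), Real.sqrt_sq (norm_nonneg _)]

/-- the triangle inequality in `√nsq`. [folklore] -/
theorem sqrt_nsq_add_le {m : Type*} [Fintype m] (f g : m → ℂ) : Real.sqrt (nsq (f + g)) ≤ Real.sqrt (nsq f) + Real.sqrt (nsq g) := by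
  have e1 : ∀ h : m → ℂ, Real.sqrt (nsq h) = ‖(WithLp.equiv 2 _).symm h‖ := by
    intro h; rw [EuclideanSpace.norm_eq, nsq]; rfl
  rw [e1, e1, e1, show (WithLp.equiv 2 (m → ℂ)).symm (f + g) = (WithLp.equiv 2 _).symm f + (WithLp.equiv 2 _).symm g from rfl]
  exact norm_add_le _ _

/-- **`‖c(A⁻¹)‖ ≤ γw⁻¹`** (weighted solution bound as an operator norm). [folklore] -/
theorem opNorm_conjMat_inv_le' (h : WCoercive A κ ρ γw) (hγ : 0 < γw) : ‖conjMat κ ρ ρ A⁻¹‖ ≤ γw⁻¹ := by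
  have hU : IsUnit A.det := (Matrix.isUnit_iff_isUnit_det A).mp (h.isUnit hγ)
  refine opNorm_conjMat_le_of_wbound κ ρ ρ A⁻¹ (by positivity) fun v => ?_
  have hx : A *ᵥ (A⁻¹ *ᵥ v) = v := by rw [Matrix.mulVec_mulVec, Matrix.mul_nonsing_inv A hU, Matrix.one_mulVec]
  have hs := h.solution_bound hx
  rw [inv_mul_eq_div, le_div_iff₀ hγ, mul_comm]
  exact hs

omit [DecidableEq υ] in
/-- **`‖X·c(A⁻¹)‖ ≤ √(1/γw + J/γw²)`** (weighted Gram bound as an operator norm). [folklore] -/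
theorem opNorm_X_conjMat_inv_le (hAX : A = Xᴴ * X + Y) (hY : Y.PosSemidef) (h : WCoercive A κ ρ γw) (hγ : 0 < γw) (hJ : ConjDefect A κ ρ J)
    (hJ0 : 0 ≤ J) : ‖X * conjMat κ ρ ρ A⁻¹‖ ≤ Real.sqrt (1 / γw + J / γw ^ 2) := by
  have hU : IsUnit A.det := (Matrix.isUnit_iff_isUnit_det A).mp (h.isUnit hγ)
  refine ScalarAveragedPropagator.opNorm_le_of_nsq_le_rect _ (Real.sqrt_nonneg _) fun z => ?_
  rw [Real.sq_sqrt (by positivity), ← Matrix.mulVec_mulVec, conjMat_mulVec]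
  set v := wvec (-κ) ρ z with hv
  have hx : A *ᵥ (A⁻¹ *ᵥ v) = v := by rw [Matrix.mulVec_mulVec, Matrix.mul_nonsing_inv A hU, Matrix.one_mulVec]
  have hg := h.gram_bound hAX hY hγ hJ hJ0 hx
  rw [hv, wvec_wvec_neg] at hg
  exact hg

omit [DecidableEq υ] in
/-- **`‖c(XA⁻¹)‖ ≤ √(1/γw + J/γw²) + c/γw`** (`c` = the conjugation error of `X`). [folklore] -/
theorem opNorm_conjMat_X_inv_le (hAX : A = Xᴴ * X + Y) (hY : Y.PosSemidef) (h : WCoercive A κ ρ γw) (hγ : 0 < γw) (hJ : ConjDefect A κ ρ J)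
    (hJ0 : 0 ≤ J) (hc : ‖conjMat κ ρX ρ X - X‖ ≤ c) :
    ‖conjMat κ ρX ρ (X * A⁻¹)‖ ≤ Real.sqrt (1 / γw + J / γw ^ 2) + c / γw := by
  rw [conjMat_mul κ ρX ρ ρ, show conjMat κ ρX ρ X * conjMat κ ρ ρ A⁻¹
      = X * conjMat κ ρ ρ A⁻¹ + (conjMat κ ρX ρ X - X) * conjMat κ ρ ρ A⁻¹ by rw [Matrix.sub_mul]; abel]
  calc _ ≤ ‖X * conjMat κ ρ ρ A⁻¹‖ + ‖(conjMat κ ρX ρ X - X) * conjMat κ ρ ρ A⁻¹‖ := norm_add_le _ _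
    _ ≤ Real.sqrt (1 / γw + J / γw ^ 2) + c * γw⁻¹ := add_le_add (opNorm_X_conjMat_inv_le hAX hY h hγ hJ hJ0)
        ((Matrix.l2_opNorm_mul _ _).trans (mul_le_mul hc (opNorm_conjMat_inv_le' h hγ) (norm_nonneg _) ((norm_nonneg _).trans hc)))
    _ = _ := by rw [← div_eq_mul_inv]

/-- **THE DIVERGENCE-FORM ENERGY ESTIMATE**: for `Ax = Xᴴu` (`A = XᴴX + Y`, `Y ⪰ 0`, weighted coercivity `γw > 0`, conjugation defect `J`, and
`‖conjMat κ ρ ρX Xᴴ − Xᴴ‖ ≤ c`): `‖X(e^{κρ}x)‖ ≤ K₁‖e^{κρX}u‖` and `‖e^{κρ}x‖ ≤ K₂‖e^{κρX}u‖`. [folklore] -/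
theorem divergence_energy (hAX : A = Xᴴ * X + Y) (hY : Y.PosSemidef) (h : WCoercive A κ ρ γw) (hγ : 0 < γw) (hJ : ConjDefect A κ ρ J)
    (hJ0 : 0 ≤ J) (hcH : ‖conjMat κ ρ ρX Xᴴ - Xᴴ‖ ≤ c) {x : ι → ℂ} {u : υ → ℂ} (hx : A *ᵥ x = Xᴴ *ᵥ u) :
    Real.sqrt (nsq (X *ᵥ wvec κ ρ x)) ≤ K1 γw J c * Real.sqrt (nsq (wvec κ ρX u)) ∧
      Real.sqrt (nsq (wvec κ ρ x)) ≤ K2 γw J c * Real.sqrt (nsq (wvec κ ρX u)) := by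
  set z := wvec κ ρ x with hz
  set w := wvec κ ρX u with hw
  set a := Real.sqrt (nsq (X *ᵥ z))
  set b := Real.sqrt (nsq z)
  set F := Real.sqrt (nsq w)
  have ha0 : 0 ≤ a := Real.sqrt_nonneg _
  have hb0 : 0 ≤ b := Real.sqrt_nonneg _
  have hF0 : 0 ≤ F := Real.sqrt_nonneg _
  -- the conjugated equation: `conjForm A z = ⟨z, e^{κρ}Xᴴu⟩ = ⟨z, cXᴴ w⟩ = ⟨Xz, w⟩ + ⟨z, (cXᴴ − Xᴴ)w⟩`
  have hconj : conjForm A κ ρ z = star z ⬝ᵥ wvec κ ρ (Xᴴ *ᵥ u) := WCoercive.conjForm_solution A κ ρ hx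
  have hsrc : wvec κ ρ (Xᴴ *ᵥ u) = Xᴴ *ᵥ w + (conjMat κ ρ ρX Xᴴ - Xᴴ) *ᵥ w := by
    rw [wvec_mulVec κ ρ ρX, Matrix.sub_mulVec, add_sub_cancel]
  have hbound : |(conjForm A κ ρ z).re| ≤ a * F + c * b * F := by
    rw [hconj, hsrc, dotProduct_add, Complex.add_re]
    have h1 : |(star z ⬝ᵥ (Xᴴ *ᵥ w)).re| ≤ a * F := by
      have e : star z ⬝ᵥ (Xᴴ *ᵥ w) = star (star w ⬝ᵥ (X *ᵥ z)) :=
        ScalarCovariantCTWeighted.star_dotProduct_conjTranspose_mulVec X z w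
      rw [e, Complex.star_def, Complex.conj_re]
      calc |(star w ⬝ᵥ (X *ᵥ z)).re| ≤ ‖star w ⬝ᵥ (X *ᵥ z)‖ := Complex.abs_re_le_norm _
        _ ≤ Real.sqrt (nsq w) * Real.sqrt (nsq (X *ᵥ z)) := norm_star_dotProduct_le _ _
        _ = a * F := mul_comm _ _
    have h2 : |(star z ⬝ᵥ ((conjMat κ ρ ρX Xᴴ - Xᴴ) *ᵥ w)).re| ≤ c * b * F := by
      calc _ ≤ ‖star z ⬝ᵥ ((conjMat κ ρ ρX Xᴴ - Xᴴ) *ᵥ w)‖ := Complex.abs_re_le_norm _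
        _ ≤ Real.sqrt (nsq z) * Real.sqrt (nsq ((conjMat κ ρ ρX Xᴴ - Xᴴ) *ᵥ w)) := norm_star_dotProduct_le _ _
        _ ≤ b * (c * F) := mul_le_mul_of_nonneg_left ((sqrt_nsq_mulVec_le _ _).trans (mul_le_mul_of_nonneg_right hcH hF0)) hb0
        _ = c * b * F := by ring
    have := abs_add_le (star z ⬝ᵥ (Xᴴ *ᵥ w)).re (star z ⬝ᵥ ((conjMat κ ρ ρX Xᴴ - Xᴴ) *ᵥ w)).re
    linarith
  -- the two energy inequalities
  have hE1 : γw * b ^ 2 ≤ a * F + c * b * F := by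
    have h1 := h z
    rw [show nsq z = b ^ 2 from (Real.sq_sqrt (nsq_nonneg _)).symm] at h1
    exact h1.trans ((le_abs_self _).trans hbound)
  have hE2 : a ^ 2 ≤ a * F + c * b * F + J * b ^ 2 := by
    have hg : nsq (X *ᵥ z) ≤ (star z ⬝ᵥ (A *ᵥ z)).re := nsq_le_re_form hAX hY z
    have hd := hJ z
    rw [abs_le] at hd
    rw [show a ^ 2 = nsq (X *ᵥ z) from Real.sq_sqrt (nsq_nonneg _), show b ^ 2 = nsq z from Real.sq_sqrt (nsq_nonneg _)]
    linarith [le_abs_self (conjForm A κ ρ z).re, hd.1]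
  exact energy_bound hγ hJ0 ha0 hb0 hF0 hE1 hE2

/-- **`‖c(A⁻¹Xᴴ)‖ ≤ K₂`**. [folklore] -/
theorem opNorm_conjMat_inv_XH_le (hAX : A = Xᴴ * X + Y) (hY : Y.PosSemidef) (h : WCoercive A κ ρ γw) (hγ : 0 < γw) (hJ : ConjDefect A κ ρ J)
    (hJ0 : 0 ≤ J) (hcH : ‖conjMat κ ρ ρX Xᴴ - Xᴴ‖ ≤ c) : ‖conjMat κ ρ ρX (A⁻¹ * Xᴴ)‖ ≤ K2 γw J c := by
  have hU : IsUnit A.det := (Matrix.isUnit_iff_isUnit_det A).mp (h.isUnit hγ)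
  refine opNorm_conjMat_le_of_wbound κ ρ ρX _ (K2_nonneg _ _ _) fun u => ?_
  have hx : A *ᵥ ((A⁻¹ * Xᴴ) *ᵥ u) = Xᴴ *ᵥ u := by
    rw [Matrix.mulVec_mulVec, ← Matrix.mul_assoc, Matrix.mul_nonsing_inv A hU, Matrix.one_mul]
  exact (divergence_energy hAX hY h hγ hJ hJ0 hcH hx).2

/-- **`‖X·c(A⁻¹Xᴴ)‖ ≤ K₁`**. [folklore] -/
theorem opNorm_X_conjMat_inv_XH_le (hAX : A = Xᴴ * X + Y) (hY : Y.PosSemidef) (h : WCoercive A κ ρ γw) (hγ : 0 < γw) (hJ : ConjDefect A κ ρ J)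
    (hJ0 : 0 ≤ J) (hcH : ‖conjMat κ ρ ρX Xᴴ - Xᴴ‖ ≤ c) : ‖X * conjMat κ ρ ρX (A⁻¹ * Xᴴ)‖ ≤ K1 γw J c := by
  have hU : IsUnit A.det := (Matrix.isUnit_iff_isUnit_det A).mp (h.isUnit hγ)
  refine ScalarAveragedPropagator.opNorm_le_of_nsq_le_rect _ (K1_nonneg _ _ _) fun w => ?_
  rw [← Matrix.mulVec_mulVec, conjMat_mulVec]
  set u := wvec (-κ) ρX w with hu
  have hx : A *ᵥ ((A⁻¹ * Xᴴ) *ᵥ u) = Xᴴ *ᵥ u := by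
    rw [Matrix.mulVec_mulVec, ← Matrix.mul_assoc, Matrix.mul_nonsing_inv A hU, Matrix.one_mul]
  have h1 := (divergence_energy hAX hY h hγ hJ hJ0 hcH hx).1
  rw [hu, wvec_wvec_neg] at h1
  have h0 : 0 ≤ Real.sqrt (nsq (X *ᵥ wvec κ ρ ((A⁻¹ * Xᴴ) *ᵥ wvec (-κ) ρX w))) := Real.sqrt_nonneg _
  have h2 := mul_self_le_mul_self h0 h1
  rw [Real.mul_self_sqrt (nsq_nonneg _), mul_mul_mul_comm, Real.mul_self_sqrt (nsq_nonneg _), ← sq] at h2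
  exact h2

/-- **`‖c(XA⁻¹Xᴴ)‖ ≤ K₁ + c·K₂`** (`c(X·M) = cX·cM = X·cM + (cX − X)·cM`). [folklore] -/
theorem opNorm_conjMat_X_inv_XH_le (hAX : A = Xᴴ * X + Y) (hY : Y.PosSemidef) (h : WCoercive A κ ρ γw) (hγ : 0 < γw) (hJ : ConjDefect A κ ρ J)
    (hJ0 : 0 ≤ J) (hc : ‖conjMat κ ρX ρ X - X‖ ≤ c) (hcH : ‖conjMat κ ρ ρX Xᴴ - Xᴴ‖ ≤ c) :
    ‖conjMat κ ρX ρX (X * (A⁻¹ * Xᴴ))‖ ≤ K1 γw J c + c * K2 γw J c := by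
  rw [conjMat_mul κ ρX ρ ρX, show conjMat κ ρX ρ X * conjMat κ ρ ρX (A⁻¹ * Xᴴ)
      = X * conjMat κ ρ ρX (A⁻¹ * Xᴴ) + (conjMat κ ρX ρ X - X) * conjMat κ ρ ρX (A⁻¹ * Xᴴ) by rw [Matrix.sub_mul]; abel]
  calc _ ≤ ‖X * conjMat κ ρ ρX (A⁻¹ * Xᴴ)‖ + ‖(conjMat κ ρX ρ X - X) * conjMat κ ρ ρX (A⁻¹ * Xᴴ)‖ := norm_add_le _ _
    _ ≤ K1 γw J c + c * K2 γw J c := add_le_add (opNorm_X_conjMat_inv_XH_le hAX hY h hγ hJ hJ0 hcH)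
        ((Matrix.l2_opNorm_mul _ _).trans (mul_le_mul hc (opNorm_conjMat_inv_XH_le hAX hY h hγ hJ hJ0 hcH) (norm_nonneg _)
          ((norm_nonneg _).trans hc)))

end Operator

end Summit.QuantumFields.BalabanUV.T4Continuum.CTWeightedEnergy

end
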